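import Summits.KontsevichZagierPeriods.KontsevichZagierPeriods.Theorems.SoloInformedRealParamTransferBdd
import Summits.KontsevichZagierPeriods.KontsevichZagierPeriods.Theorems.SoloInformedDefMoveChangeOfVariables
import Summits.KontsevichZagierPeriods.KontsevichZagierPeriods.Theorems.SoloInformedDefMoveDomainAdd
import HarnessLib

/-!
# THEOREM R and THEOREM T for bounded chains — unconditional

The four bounded moves of `KZ_ℝ` are definable (`soloInformed_definableRel_bddDomainAddRel`,
`…IntegrandAddRel`, `…ChangeOfVariablesRel`, `…NewtonLeibnizRel`), so the hypothesis `hgen` of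
`soloInformed_realParameterBarrier_bdd` / `soloInformed_realParameterTransfer_bdd` is a theorem
(`soloInformed_definableRel_bddGenerators`) and both results hold unconditionally:

* **THEOREM R** (`soloInformed_realParameterBarrier`): a bounded `ℚ`-representation with
  transcendental value is not connected to any rectangle `[[0,1] × [0,ℓ], 1]` by a bounded chain
  of Kontsevich–Zagier moves with *real* semialgebraic data;
* **THEOREM T** (`soloInformed_realParameterTransfer`): bounded `KZ_ℝ`-equivalence of the base
  changes of two bounded `ℚ`-representations implies (indeed is equivalent to) bounded
  `KZ_ℚ`-equivalence, hence `KZ`-equivalence over `ℚ`.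

So for bounded chains real parameters add nothing: the PAPER clause of the seat's VERDICT §4 is
now kernel-checked in the bounded regime.  (Unbounded chains additionally need integrability loci
of semialgebraic families; not treated.)

References: [cite: KontsevichZagier2001, §1.2, Conjecture 1]; [cite: HuberMullerStach2017, §12.1,
§13.1]; [cite: BochnakCosteRoy1998, Prop. 2.2.4].
-/

noncomputable section

open Set Literature.NumberTheory.Transcendental

namespace Summit.KontsevichZagierPeriods.KontsevichZagierPeriods.Theorems

/-- **The four bounded moves of `KZ_ℝ` are definable.** [cite: KontsevichZagier2001, §1.2] -/
theorem soloInformed_definableRel_bddGenerators :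
    ∀ c ∈ soloInformedBddGenerators ℝ, SoloInformedDefinableRel c := by
  rintro c (((hD | hI) | hC) | hN)
  · exact soloInformed_definableRel_bddDomainAddRel c hD
  · exact soloInformed_definableRel_bddIntegrandAddRel c hI
  · exact soloInformed_definableRel_bddChangeOfVariablesRel c hC
  · exact soloInformed_definableRel_bddNewtonLeibnizRel c hN

/-- **THEOREM R (bounded chains, unconditional).** A bounded `ℚ`-representation with
transcendental value is not boundedly `KZ_ℝ`-related to any rectangle `[[0,1] × [0,ℓ], 1]`,
`ℓ ≥ 0`. [cite: KontsevichZagier2001, §1.2, Conjecture 1] -/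
theorem soloInformed_realParameterBarrier {n : ℕ} (r : KZOver.IntegralRep ℚ n)
    (hr : SoloInformedBddRep r) (hτ : Transcendental ℚ r.value) {ℓ : ℝ} (hℓ : 0 ≤ ℓ) :
    KZOver.of (r.baseChange ℝ) - KZOver.of (soloInformedRealRect ℓ) ∉
      soloInformedRelationsBdd ℝ :=
  soloInformed_realParameterBarrier_bdd soloInformed_definableRel_bddGenerators r hr hτ hℓ

/-- **THEOREM R, all heights (unconditional).** [cite: KontsevichZagier2001, §1.2, Conjecture 1] -/
theorem soloInformed_realParameterBarrier' {n : ℕ} (r : KZOver.IntegralRep ℚ n)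
    (hr : SoloInformedBddRep r) (hτ : Transcendental ℚ r.value) (ℓ : ℝ) :
    ¬ SoloInformedBddEquivalent (r.baseChange ℝ) (soloInformedRealRect ℓ) :=
  soloInformed_realParameterBarrier_bdd' soloInformed_definableRel_bddGenerators r hr hτ ℓ

/-- **THEOREM T (bounded chains, unconditional).** Bounded `KZ_ℝ`-equivalence of the base
changes of two bounded `ℚ`-representations implies bounded `KZ_ℚ`-equivalence.
[cite: KontsevichZagier2001, §1.2, Conjecture 1] -/
theorem soloInformed_realParameterTransfer {n n' : ℕ} (r : KZOver.IntegralRep ℚ n)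
    (r' : KZOver.IntegralRep ℚ n') (hr : SoloInformedBddRep r) (hr' : SoloInformedBddRep r')
    (hc : KZOver.of (r.baseChange ℝ) - KZOver.of (r'.baseChange ℝ) ∈ soloInformedRelationsBdd ℝ) :
    KZOver.of r - KZOver.of r' ∈ soloInformedRelationsBdd ℚ :=
  soloInformed_realParameterTransfer_bdd soloInformed_definableRel_bddGenerators r r' hr hr' hc

/-- **Corollary T1 (unconditional).** Bounded `KZ_ℝ`-equivalence of the base changes implies
`KZ`-equivalence over `ℚ`. [cite: KontsevichZagier2001, §1.2, Conjecture 1] -/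
theorem soloInformed_equivalent_of_bddEquivalent_baseChange {n n' : ℕ}
    (r : KZOver.IntegralRep ℚ n) (r' : KZOver.IntegralRep ℚ n') (hr : SoloInformedBddRep r)
    (hr' : SoloInformedBddRep r')
    (h : SoloInformedBddEquivalent (r.baseChange ℝ) (r'.baseChange ℝ)) :
    SoloInformedBddEquivalent r r' ∧ KZOver.Equivalent r r' :=
  soloInformed_equivalent_of_bddEquivalent_real soloInformed_definableRel_bddGenerators r r' hr
    hr' h

/-- **Corollary T2 (unconditional): real and rational bounded equivalence coincide** on base
changes of bounded `ℚ`-representations. [cite: KontsevichZagier2001, §1.2] -/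
theorem soloInformed_bddEquivalent_baseChange_iff_bddEquivalent {n n' : ℕ}
    (r : KZOver.IntegralRep ℚ n) (r' : KZOver.IntegralRep ℚ n') (hr : SoloInformedBddRep r)
    (hr' : SoloInformedBddRep r') :
    SoloInformedBddEquivalent (r.baseChange ℝ) (r'.baseChange ℝ) ↔ SoloInformedBddEquivalent r r' :=
  soloInformed_bddEquivalent_baseChange_iff soloInformed_definableRel_bddGenerators r r' hr hr'

end Summit.KontsevichZagierPeriods.KontsevichZagierPeriods.Theorems
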